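import Mathlib.Algebra.BigOperators.Finprod
import Mathlib.LinearAlgebra.Dual.Lemmas
import Literature.NumberTheory.Automorphic.RestrictedTensorProductProofs
import HarnessLib

/-!
# Restricted tensor products: existence (proofs)

Topic `NumberTheory/Automorphic`; proof file for
`Literature/NumberTheory/Automorphic/RestrictedTensorProduct.lean`, discharging sorry-free the
named fact `Literature.NumberTheory.Automorphic.exists_isRestrictedTensorProductRep` stated there:
over a field `k`, for representations `ρ i` of groups `G i` on `V i`, subgroups `K i`, base
vectors `x₀ i` which are eventually `K i`-fixed and non-zero off a finite set `S₀`, there is a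
representation `π` of the restricted product `Πʳ i, [G i, K i]` on a space `W` and an
equivariant restricted-multilinear `j : RestrictedFamily V x₀ → W` such that `(W, π, j)` is a
restricted tensor product of the `ρ i` with exceptional set `S₀`
(`exists_isRestrictedTensorProductRep_holds`).

Sources. Flath, *Decomposition of representations into tensor products* (Corvallis 1979), §2:
the restricted tensor product `⊗' (V i, x₀ i)` as the direct limit `lim_S ⨂_{i ∈ S} V i` along
the maps inserting the base vectors, and Example 2 (the resulting representation of a restricted
product group); Bump, *Automorphic forms and representations* (1997), §3.3 (the same
definition: `⊗_v V_v = lim_S ⊗_{v ∈ S} V_v` along the injective maps `λ_{S,S'}` tensoring with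
the `x_v°`, and the representation `(⊗_v ρ_v)(g) (⊗ ξ_v) = ⊗ ρ_v(g_v) ξ_v` of the restricted
direct product when the `ξ_v°` are `K_v`-fixed).

## The construction

Rather than Mathlib's `Module.DirectLimit` we realise the restricted tensor product by its
universal property, exactly as Mathlib realises `PiTensorProduct`:

* `RestrictedTensorProduct k x₀` is the quotient of the free module
  `RestrictedFamily V x₀ →₀ k` by the submodule `RestrictedTensorProduct.relations k x₀`
  spanned by the multilinearity relations in each coordinate, and
  `RestrictedTensorProduct.tprod k x` ("`⊗'_i x i`") is the class of `single x 1`; it is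
  restricted-multilinear by construction (`isRestrictedMultilinear_tprod`) and universal:
  every restricted-multilinear `φ` factors as `lift hφ ∘ tprod` (`lift_tprod`, `hom_ext`).
  Since every restricted family is the base family off some finite `S`, the values `tprod k x`
  lie in the ranges of the finite-level maps `liftFinset S : ⨂_{i ∈ S} V i → W`, which
  therefore exhaust `W` (`iSup_range_liftFinset`). By the uniqueness theorem of the statement
  file (`IsRestrictedTensorProductRep.unique`) this object is canonically isomorphic to the
  direct limit of the printed definition.
* The group `Πʳ i, [G i, K i]` acts through the universal property: `x ↦ ⊗' (ρ i (g i) (x i))`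
  is restricted-multilinear (`IsRestrictedMultilinear.comp_smul`), whence linear maps
  `rep ρ hx₀ g` with `rep g (⊗' x) = ⊗' (g • x)`; `rep 1 = 1` and `rep (g h) = rep g ∘ rep h` are
  checked on the spanning pure tensors (Flath 1979, §2, Example 2).
* **Injectivity of the finite levels** (the only place where `k` is a field and the base
  vectors are non-zero): for a finite `S ⊇ S₀` choose linear forms `ℓ i : V i → k` with
  `ℓ i (x₀ i) = 1` for `i ∉ S` (`Module.Projective.exists_dual_eq_one`). The map
  `x ↦ (∏ᶠ_{i ∉ S} ℓ i (x i)) • ⊗_{i ∈ S} x i` (a finite product: almost all factors are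
  `ℓ i (x₀ i) = 1`) is restricted-multilinear (`isRestrictedMultilinear_retraction`), so it
  induces a linear retraction `W → ⨂_{i ∈ S} V i` of `liftFinset S`
  (`lift_retraction_liftFinset_apply`), which is therefore injective. This is the usual proof
  that `t ↦ t ⊗ x₀` is injective for `x₀ ≠ 0` over a field, i.e. that the transition maps
  `λ_{S,S'}` of the direct system are injective (Bump 1997, §3.3; Flath 1979, §2).

What is NOT here: smoothness / admissibility / irreducibility of the restricted tensor product
(the sibling files `RestrictedTensorProduct{Smooth,Admissible,Irreducible}Proofs.lean`) and
uniqueness / independence of the base vectors (`RestrictedTensorProductProofs.lean`).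

## References

* D. Flath, *Decomposition of representations into tensor products*, Proc. Sympos. Pure Math.
  33 (Corvallis 1979), part 1, 179–183, §2 and Example 2. [Flath1979]
* D. Bump, *Automorphic forms and representations*, Cambridge Stud. Adv. Math. 55, Cambridge
  1997, §3.3.
-/

open scoped RestrictedProduct TensorProduct
open Filter

namespace Literature.NumberTheory.Automorphic

universe u uk uG v w

/-! ### Restriction of restricted families to a finset -/

namespace RestrictedFamily

variable {ι : Type u} {V : ι → Type v} {x₀ : ∀ i, V i}

/-- The restriction `(x i)_{i ∈ S}` of a restricted family to a finset `S`: the finite family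
whose tensor product `⊗_{i ∈ S} x i` represents `⊗' x` at the finite level `S` whenever `x` is the
base family off `S`. [folklore] -/
def restrict (S : Finset ι) (x : RestrictedFamily V x₀) : ∀ i : S, V i := fun i => x i

/-- Coordinates of the restriction. [folklore] -/
@[simp] lemma restrict_apply (S : Finset ι) (x : RestrictedFamily V x₀) (i : S) :
    x.restrict S i = x i := rfl

variable [DecidableEq ι]

/-- Restricting the extension of a finite family recovers it. [folklore] -/
@[simp] lemma restrict_extend (S : Finset ι) (m : ∀ i : S, V i) :
    (extend (x₀ := x₀) S m).restrict S = m :=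
  funext fun i => extend_apply_coe S m i

/-- Restriction to `S` commutes with updating a coordinate in `S`. [folklore] -/
lemma restrict_update_of_mem (S : Finset ι) (x : RestrictedFamily V x₀) {i : ι} (hi : i ∈ S)
    (u : V i) : (x.update i u).restrict S = Function.update (x.restrict S) ⟨i, hi⟩ u :=
  Function.update_comp_eq_of_injective' (⇑x) Subtype.val_injective ⟨i, hi⟩ u

/-- Restriction to `S` ignores updates of coordinates off `S`. [folklore] -/
lemma restrict_update_of_notMem (S : Finset ι) (x : RestrictedFamily V x₀) {i : ι} (hi : i ∉ S)
    (u : V i) : (x.update i u).restrict S = x.restrict S :=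
  funext fun i' => Function.update_of_ne (fun h : (i' : ι) = i => hi (by rw [← h]; exact i'.2)) u (⇑x)

end RestrictedFamily

/-! ### The construction: free module on restricted families modulo multilinearity -/

section Module

variable {ι : Type u} (k : Type uk) [CommRing k] {V : ι → Type v} [∀ i, AddCommGroup (V i)]
  [∀ i, Module k (V i)] (x₀ : ∀ i, V i) [DecidableEq ι]

/-- The submodule of the free `k`-module on the restricted families spanned by the
multilinearity relations `[x; i ↦ v + w] - [x; i ↦ v] - [x; i ↦ w]` and
`[x; i ↦ c • v] - c • [x; i ↦ v]` in each coordinate `i` (all other coordinates fixed). The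
quotient by it is the restricted tensor product. (Flath 1979, §2; cf. Mathlib's
`PiTensorProduct`.) [cite: Flath1979, §2] -/
noncomputable def RestrictedTensorProduct.relations : Submodule k (RestrictedFamily V x₀ →₀ k) :=
  Submodule.span k
    ({f | ∃ (x : RestrictedFamily V x₀) (i : ι) (v w : V i),
        f = Finsupp.single (x.update i (v + w)) 1 - Finsupp.single (x.update i v) 1 -
          Finsupp.single (x.update i w) 1} ∪
      {f | ∃ (x : RestrictedFamily V x₀) (i : ι) (c : k) (v : V i),
        f = Finsupp.single (x.update i (c • v)) 1 - c • Finsupp.single (x.update i v) 1})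

/-- **The restricted tensor product** `⊗'_i (V i, x₀ i)` of a family of `k`-modules with base
vectors `x₀ i`: the free `k`-module on the restricted families `x` (families with `x i = x₀ i`
for almost all `i`) modulo the multilinearity relations in each coordinate. It carries the
universal restricted-multilinear map `RestrictedTensorProduct.tprod`, and is the direct limit
`lim_S ⨂_{i ∈ S} V i` of Flath's definition (it satisfies the characterising predicate
`IsRestrictedTensorProduct`, see `RestrictedTensorProduct.isRestrictedTensorProductRep`, hence is
isomorphic to any other model by `IsRestrictedTensorProductRep.unique`).
(Flath 1979, §2; Bump 1997, §3.3.) [cite: Flath1979, §2] -/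
abbrev RestrictedTensorProduct : Type (max u uk v) :=
  (RestrictedFamily V x₀ →₀ k) ⧸ RestrictedTensorProduct.relations k x₀

namespace RestrictedTensorProduct

variable {x₀}

/-- The pure restricted tensor `⊗'_i x i` of a restricted family `x`: the class of the generator
`[x]` of the free module. (Flath 1979, §2.) [cite: Flath1979, §2] -/
noncomputable def tprod (x : RestrictedFamily V x₀) : RestrictedTensorProduct k x₀ :=
  Submodule.Quotient.mk (Finsupp.single x 1)

/-- Unfolding lemma for `tprod`. [folklore] -/
lemma tprod_def (x : RestrictedFamily V x₀) :
    tprod k x = Submodule.Quotient.mk (Finsupp.single x 1) := rfl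

variable {k}

/-- The map `x ↦ ⊗'_i x i` is restricted-multilinear (by construction of the relations).
(Flath 1979, §2.) [cite: Flath1979, §2] -/
theorem isRestrictedMultilinear_tprod : IsRestrictedMultilinear k (tprod k (x₀ := x₀)) where
  map_update_add x i v w := by
    rw [tprod_def, tprod_def, tprod_def, ← Submodule.Quotient.mk_add, Submodule.Quotient.eq,
      sub_add_eq_sub_sub]
    exact Submodule.subset_span (Or.inl ⟨x, i, v, w, rfl⟩)
  map_update_smul x i c v := by
    rw [tprod_def, tprod_def, ← Submodule.Quotient.mk_smul, Submodule.Quotient.eq]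
    exact Submodule.subset_span (Or.inr ⟨x, i, c, v, rfl⟩)

/-- The pure restricted tensors span the restricted tensor product. [folklore] -/
theorem span_range_tprod : Submodule.span k (Set.range (tprod k (x₀ := x₀))) = ⊤ := by
  refine Submodule.eq_top_iff'.2 fun t => ?_
  obtain ⟨f, rfl⟩ := Submodule.Quotient.mk_surjective _ t
  induction f using Finsupp.induction_linear with
  | zero => rw [Submodule.Quotient.mk_zero]; exact zero_mem _
  | add f g hf hg => rw [Submodule.Quotient.mk_add]; exact add_mem hf hg
  | single x c =>
    rw [← Finsupp.smul_single_one, Submodule.Quotient.mk_smul]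
    exact Submodule.smul_mem _ c (Submodule.subset_span ⟨x, rfl⟩)

/-- The ranges of the finite-level maps `⨂_{i ∈ S} V i → ⊗'_i V i`, `⊗ m ↦ ⊗' (extend S m)`,
exhaust the restricted tensor product: every restricted family is the base family off some
finite `S`. (Flath 1979, §2.) [cite: Flath1979, §2] -/
theorem iSup_range_liftFinset :
    ⨆ S : Finset ι, LinearMap.range
      ((isRestrictedMultilinear_tprod (k := k) (x₀ := x₀)).liftFinset S) = ⊤ := by
  rw [eq_top_iff, ← span_range_tprod, Submodule.span_le]
  rintro _ ⟨x, rfl⟩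
  obtain ⟨S, -, hS⟩ :=
    RestrictedFamily.exists_finset_forall_apply_eq (∅ : Finset ι) ({x} : Finset _)
  exact Submodule.mem_iSup_of_mem S (isRestrictedMultilinear_tprod.apply_mem_range_liftFinset S x
    (hS x (Finset.mem_singleton_self x)))

/-! ### The universal property -/

variable {W : Type w} [AddCommGroup W] [Module k W] {φ : RestrictedFamily V x₀ → W}

/-- A restricted-multilinear map kills the multilinearity relations. [folklore] -/
theorem relations_le_ker (hφ : IsRestrictedMultilinear k φ) :
    relations k x₀ ≤ LinearMap.ker (Finsupp.linearCombination k φ) := by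
  refine Submodule.span_le.2 ?_
  rintro _ (⟨x, i, v, w, rfl⟩ | ⟨x, i, c, v, rfl⟩)
  · simp [hφ.map_update_add]
  · simp [hφ.map_update_smul]

/-- **Universal property of the restricted tensor product**: the linear map
`⊗'_i V i → W` induced by a restricted-multilinear `φ : RestrictedFamily V x₀ → W`.
(Flath 1979, §2.) [cite: Flath1979, §2] -/
noncomputable def lift (hφ : IsRestrictedMultilinear k φ) : RestrictedTensorProduct k x₀ →ₗ[k] W :=
  (relations k x₀).liftQ (Finsupp.linearCombination k φ) (relations_le_ker hφ)

/-- `lift hφ (⊗' x) = φ x`. [folklore] -/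
@[simp] theorem lift_tprod (hφ : IsRestrictedMultilinear k φ) (x : RestrictedFamily V x₀) :
    lift hφ (tprod k x) = φ x := by
  simp [lift, tprod_def]

/-- Linear maps out of the restricted tensor product are determined by their values on pure
restricted tensors. [folklore] -/
theorem hom_ext {F₁ F₂ : RestrictedTensorProduct k x₀ →ₗ[k] W}
    (h : ∀ x, F₁ (tprod k x) = F₂ (tprod k x)) : F₁ = F₂ :=
  Submodule.linearMap_qext _ <| Finsupp.lhom_ext' fun x => LinearMap.ext_ring (h x)

/-! ### Injectivity of the finite levels: a retraction -/

section Retraction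

variable (S : Finset ι) (ℓ : ∀ i, V i →ₗ[k] k)

/-- The factors `ℓ i (x i)` for `i ∉ S` (and `1` for `i ∈ S`) of the scalar
`∏_{i ∉ S} ℓ i (x i)` in the retraction `⊗' x ↦ (∏_{i ∉ S} ℓ i (x i)) • ⊗_{i ∈ S} x i`.
[folklore] -/
def retractionFactor (x : ∀ i, V i) (i : ι) : k := if i ∈ S then 1 else ℓ i (x i)

/-- The map `x ↦ (∏ᶠ_{i ∉ S} ℓ i (x i)) • ⊗_{i ∈ S} x i` from restricted families to the finite
tensor product over `S`; when `ℓ i (x₀ i) = 1` for `i ∉ S` the product is finite and the map is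
restricted-multilinear, inducing a retraction of `liftFinset S`. [folklore] -/
noncomputable def retraction (x : RestrictedFamily V x₀) : ⨂[k] i : S, V i :=
  (∏ᶠ i, retractionFactor S ℓ (⇑x) i) • PiTensorProduct.tprod k (x.restrict S)

variable {S ℓ}

/-- If `ℓ i (x₀ i) = 1` off `S`, the factors of `x` are `1` off any finset off which `x` is the
base family. [folklore] -/
theorem mulSupport_retractionFactor_subset (hℓ : ∀ i ∉ S, ℓ i (x₀ i) = 1)
    (x : RestrictedFamily V x₀) (T : Finset ι) (hT : ∀ i ∉ T, x i = x₀ i) :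
    Function.mulSupport (retractionFactor S ℓ (⇑x)) ⊆ ↑T := by
  intro i hi
  by_contra hiT
  refine hi ?_
  simp only [retractionFactor]
  split_ifs with hiS
  · rfl
  · rw [hT i (fun h => hiT (Finset.mem_coe.2 h)), hℓ i hiS]

/-- The finite product `∏ᶠ_i` of the factors is the product over any finset off which `x` is the
base family. [folklore] -/
theorem finprod_retractionFactor_eq_prod (hℓ : ∀ i ∉ S, ℓ i (x₀ i) = 1)
    (x : RestrictedFamily V x₀) (T : Finset ι) (hT : ∀ i ∉ T, x i = x₀ i) :
    ∏ᶠ i, retractionFactor S ℓ (⇑x) i = ∏ i ∈ T, retractionFactor S ℓ (⇑x) i :=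
  finprod_eq_prod_of_mulSupport_subset _ (mulSupport_retractionFactor_subset hℓ x T hT)

/-- Dependence of the retraction on one coordinate `i`: for fixed `x` there is a scalar `P`
(the product of the factors at the other coordinates) with
`retraction (x[i ↦ u]) = ((if i ∈ S then 1 else ℓ i u) * P) • ⊗_{i' ∈ S} x[i ↦ u] i'` for all
`u`. [folklore] -/
theorem exists_retraction_update_eq (hℓ : ∀ i ∉ S, ℓ i (x₀ i) = 1) (x : RestrictedFamily V x₀)
    (i : ι) : ∃ P : k, ∀ u : V i, retraction S ℓ (x.update i u) =
      ((if i ∈ S then 1 else ℓ i u) * P) • PiTensorProduct.tprod k ((x.update i u).restrict S) := by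
  obtain ⟨T, hiT, hT⟩ :=
    RestrictedFamily.exists_finset_forall_apply_eq ({i} : Finset ι) ({x} : Finset _)
  have hi : i ∈ T := hiT (Finset.mem_singleton_self i)
  have hxT : ∀ i' ∉ T, x i' = x₀ i' := hT x (Finset.mem_singleton_self x)
  have huT : ∀ (u : V i), ∀ i' ∉ T, x.update i u i' = x₀ i' := fun u i' hi' => by
    rw [RestrictedFamily.update_apply, Function.update_of_ne (fun h : i' = i => hi' (by rw [h]; exact hi)),
      hxT i' hi']
  refine ⟨∏ i' ∈ T.erase i, retractionFactor S ℓ (⇑x) i', fun u => ?_⟩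
  have h1 : retractionFactor S ℓ (⇑(x.update i u)) i = if i ∈ S then 1 else ℓ i u := by
    simp [retractionFactor]
  have h2 : ∏ i' ∈ T.erase i, retractionFactor S ℓ (⇑(x.update i u)) i' =
      ∏ i' ∈ T.erase i, retractionFactor S ℓ (⇑x) i' :=
    Finset.prod_congr rfl fun i' hi' => by
      simp [retractionFactor, Function.update_of_ne (Finset.ne_of_mem_erase hi')]
  rw [retraction, finprod_retractionFactor_eq_prod hℓ _ T (huT u), ← Finset.mul_prod_erase T _ hi,
    h1, h2]

/-- The map `x ↦ (∏ᶠ_{i ∉ S} ℓ i (x i)) • ⊗_{i ∈ S} x i` is restricted-multilinear when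
`ℓ i (x₀ i) = 1` for `i ∉ S`. [folklore] -/
theorem isRestrictedMultilinear_retraction (hℓ : ∀ i ∉ S, ℓ i (x₀ i) = 1) :
    IsRestrictedMultilinear k (retraction (x₀ := x₀) S ℓ) where
  map_update_add x i v w := by
    obtain ⟨P, hP⟩ := exists_retraction_update_eq hℓ x i
    rw [hP, hP, hP]
    by_cases hiS : i ∈ S
    · simp only [if_pos hiS, one_mul, RestrictedFamily.restrict_update_of_mem S x hiS,
        MultilinearMap.map_update_add, smul_add]
    · simp only [if_neg hiS, RestrictedFamily.restrict_update_of_notMem S x hiS, map_add, add_mul,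
        add_smul]
  map_update_smul x i c v := by
    obtain ⟨P, hP⟩ := exists_retraction_update_eq hℓ x i
    rw [hP, hP]
    by_cases hiS : i ∈ S
    · simp only [if_pos hiS, one_mul, RestrictedFamily.restrict_update_of_mem S x hiS,
        MultilinearMap.map_update_smul]
      rw [smul_comm]
    · simp only [if_neg hiS, RestrictedFamily.restrict_update_of_notMem S x hiS, map_smul,
        smul_eq_mul]
      rw [mul_assoc, mul_smul]

/-- The linear map induced by the retraction is a left inverse of the finite-level map
`liftFinset S : ⨂_{i ∈ S} V i → ⊗'_i V i`: on `⊗ m` the scalar is `∏_{i ∉ S} ℓ i (x₀ i) = 1`.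
[folklore] -/
theorem lift_retraction_liftFinset_apply (hℓ : ∀ i ∉ S, ℓ i (x₀ i) = 1) (t : ⨂[k] i : S, V i) :
    lift (isRestrictedMultilinear_retraction hℓ)
      ((isRestrictedMultilinear_tprod (k := k) (x₀ := x₀)).liftFinset S t) = t := by
  induction t using PiTensorProduct.induction_on with
  | smul_tprod c m =>
    have h1 : ∀ i, retractionFactor S ℓ (⇑(RestrictedFamily.extend (x₀ := x₀) S m)) i = 1 := by
      intro i
      simp only [retractionFactor]
      split_ifs with h
      · rfl
      · rw [RestrictedFamily.extend_apply_of_notMem _ _ h, hℓ i h]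
    rw [map_smul, map_smul, IsRestrictedMultilinear.liftFinset_tprod, lift_tprod, retraction,
      finprod_eq_one_of_forall_eq_one h1, one_smul, RestrictedFamily.restrict_extend]
  | add a b ha hb => rw [map_add, map_add, ha, hb]

/-- **Injectivity of the finite levels.** If there are linear forms `ℓ i` with `ℓ i (x₀ i) = 1`
for `i ∉ S`, the map `⨂_{i ∈ S} V i → ⊗'_i V i` is injective. (Flath 1979, §2; Bump 1997,
§3.3: the maps `λ_{S,S'}` are injective.) [cite: Flath1979, §2] -/
theorem injective_liftFinset (hℓ : ∀ i ∉ S, ℓ i (x₀ i) = 1) :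
    Function.Injective ((isRestrictedMultilinear_tprod (k := k) (x₀ := x₀)).liftFinset S) :=
  Function.LeftInverse.injective (lift_retraction_liftFinset_apply hℓ)

end Retraction

end RestrictedTensorProduct

end Module

/-! ### Linear forms normalised at the base vectors (fields) -/

section Field

variable {ι : Type u} {k : Type uk} [Field k] {V : ι → Type v} [∀ i, AddCommGroup (V i)]
  [∀ i, Module k (V i)] {x₀ : ∀ i, V i}

/-- Over a field, if `x₀ i ≠ 0` off `S` there are linear forms `ℓ i : V i → k` with
`ℓ i (x₀ i) = 1` for all `i ∉ S`. [folklore] -/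
theorem exists_forall_dual_apply_eq_one (S : Finset ι) (hS : ∀ i ∉ S, x₀ i ≠ 0) :
    ∃ ℓ : ∀ i, V i →ₗ[k] k, ∀ i ∉ S, ℓ i (x₀ i) = 1 := by
  have h : ∀ i, ∃ ℓ : V i →ₗ[k] k, i ∉ S → ℓ (x₀ i) = 1 := fun i => by
    by_cases hi : i ∈ S
    · exact ⟨0, fun h => (h hi).elim⟩
    · obtain ⟨f, hf⟩ := Module.Projective.exists_dual_eq_one k (hS i hi)
      exact ⟨f, fun _ => hf⟩
  choose ℓ hℓ using h
  exact ⟨ℓ, hℓ⟩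

end Field

/-! ### The representation of the restricted product group -/

section Rep

variable {ι : Type u} {k : Type uk} [CommRing k] {G : ι → Type uG} [∀ i, Group (G i)]
  {K : ∀ i, Subgroup (G i)} {V : ι → Type v} [∀ i, AddCommGroup (V i)] [∀ i, Module k (V i)]
  (ρ : ∀ i, Representation k (G i) (V i)) {x₀ : ∀ i, V i} [DecidableEq ι]

/-- The coordinatewise action commutes with updating a coordinate (acting on the new entry by
`ρ i (g i)`). [folklore] -/
lemma RestrictedFamily.smul_update (hx₀ : ∀ᶠ i in cofinite, x₀ i ∈ (ρ i).fixedPoints (K i))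
    (g : Πʳ i, [G i, K i]) (x : RestrictedFamily V x₀) (i : ι) (v : V i) :
    RestrictedFamily.smul ρ hx₀ g (x.update i v) =
      (RestrictedFamily.smul ρ hx₀ g x).update i (ρ i (g i) v) := by
  ext j
  by_cases hj : j = i
  · subst hj
    simp
  · simp [Function.update_of_ne hj]

variable {W : Type w} [AddCommGroup W] [Module k W] {j : RestrictedFamily V x₀ → W}

/-- Precomposing a restricted-multilinear map with the coordinatewise action of `g` gives a
restricted-multilinear map (each `ρ i (g i)` is linear). (Flath 1979, §2, Example 2.)
[cite: Flath1979, §2  Example 2] -/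
lemma IsRestrictedMultilinear.comp_smul (hj : IsRestrictedMultilinear k j)
    (hx₀ : ∀ᶠ i in cofinite, x₀ i ∈ (ρ i).fixedPoints (K i)) (g : Πʳ i, [G i, K i]) :
    IsRestrictedMultilinear k (fun x => j (RestrictedFamily.smul ρ hx₀ g x)) where
  map_update_add x i v w := by
    simp only [RestrictedFamily.smul_update, map_add, hj.map_update_add]
  map_update_smul x i c v := by
    simp only [RestrictedFamily.smul_update, map_smul, hj.map_update_smul]

namespace RestrictedTensorProduct

/-- **The restricted tensor product representation** `⊗'_i ρ i` of `Πʳ i, [G i, K i]` on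
`⊗'_i (V i, x₀ i)` (base vectors eventually `K i`-fixed): `g` acts by the linear map induced,
via the universal property, by the restricted-multilinear `x ↦ ⊗' (ρ i (g i) (x i))_i`, so that
`g • ⊗' x = ⊗' (g • x)`. (Flath 1979, §2, Example 2; Bump 1997, §3.3.)
[cite: Flath1979, §2  Example 2] -/
noncomputable def rep (hx₀ : ∀ᶠ i in cofinite, x₀ i ∈ (ρ i).fixedPoints (K i)) :
    Representation k (Πʳ i, [G i, K i]) (RestrictedTensorProduct k x₀) where
  toFun g := lift (isRestrictedMultilinear_tprod.comp_smul ρ hx₀ g)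
  map_one' := hom_ext fun x => by
    rw [lift_tprod, RestrictedFamily.one_smul, Module.End.one_apply]
  map_mul' g h := hom_ext fun x => by
    rw [lift_tprod, RestrictedFamily.mul_smul, Module.End.mul_apply, lift_tprod, lift_tprod]

/-- Unfolding lemma for `rep`. [folklore] -/
lemma rep_apply (hx₀ : ∀ᶠ i in cofinite, x₀ i ∈ (ρ i).fixedPoints (K i))
    (g : Πʳ i, [G i, K i]) :
    rep ρ hx₀ g = lift (isRestrictedMultilinear_tprod.comp_smul ρ hx₀ g) := rfl

/-- `g • ⊗' x = ⊗' (g • x)`. [folklore] -/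
@[simp] lemma rep_apply_tprod (hx₀ : ∀ᶠ i in cofinite, x₀ i ∈ (ρ i).fixedPoints (K i))
    (g : Πʳ i, [G i, K i]) (x : RestrictedFamily V x₀) :
    rep ρ hx₀ g (tprod k x) = tprod k (RestrictedFamily.smul ρ hx₀ g x) := by
  rw [rep_apply, lift_tprod]

end RestrictedTensorProduct

end Rep

/-! ### Existence -/

section Existence

variable {ι : Type u} {k : Type uk} [Field k] {G : ι → Type uG} [∀ i, Group (G i)]
  {K : ∀ i, Subgroup (G i)} {V : ι → Type v} [∀ i, AddCommGroup (V i)] [∀ i, Module k (V i)]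
  {x₀ : ∀ i, V i} [DecidableEq ι]

/-- `(⊗'_i (V i, x₀ i), ⊗'_i ρ i, ⊗')` **is a restricted tensor product** of the `ρ i` in the
sense of the characterising predicate `IsRestrictedTensorProductRep`, with exceptional set any
finite `S₀` off which the base vectors are non-zero (over a field): `⊗'` is
restricted-multilinear and equivariant, the finite levels `⨂_{i ∈ S} V i → ⊗'_i V i` are
injective for `S ⊇ S₀`, and their ranges exhaust the space. (Flath 1979, §2 and Example 2;
Bump 1997, §3.3.) [cite: Flath1979, §2] -/
theorem RestrictedTensorProduct.isRestrictedTensorProductRep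
    (ρ : ∀ i, Representation k (G i) (V i)) (S₀ : Finset ι)
    (hx₀ : ∀ᶠ i in cofinite, x₀ i ∈ (ρ i).fixedPoints (K i)) (hS₀ : ∀ i ∉ S₀, x₀ i ≠ 0) :
    IsRestrictedTensorProductRep ρ (RestrictedTensorProduct.rep ρ hx₀) hx₀
      (RestrictedTensorProduct.tprod k) S₀ := by
  refine ⟨⟨RestrictedTensorProduct.isRestrictedMultilinear_tprod, fun S hS => ?_,
    RestrictedTensorProduct.iSup_range_liftFinset⟩,
    fun g x => (RestrictedTensorProduct.rep_apply_tprod ρ hx₀ g x).symm⟩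
  obtain ⟨ℓ, hℓ⟩ :=
    exists_forall_dual_apply_eq_one (k := k) (x₀ := x₀) S fun i hi => hS₀ i fun h => hi (hS h)
  exact RestrictedTensorProduct.injective_liftFinset hℓ

/-- **Existence of the restricted tensor product** (discharge of
`exists_isRestrictedTensorProductRep`): over a field, if the base vectors are eventually
`K i`-fixed and non-zero off a finite `S₀`, there is a representation `π` of `Πʳ i, [G i, K i]` on
a space `W` and an equivariant restricted-multilinear `j` making `(W, π, j)` a restricted tensor
product of the `ρ i` with exceptional set `S₀`; namely `W = ⊗'_i (V i, x₀ i)`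
(`RestrictedTensorProduct`), `π = ⊗'_i ρ i` (`RestrictedTensorProduct.rep`), `j = ⊗'`
(`RestrictedTensorProduct.tprod`). (Flath 1979, §2 and Example 2; Bump 1997, §3.3.)
[cite: Flath1979, §2] -/
theorem exists_isRestrictedTensorProductRep_holds :
    exists_isRestrictedTensorProductRep (ι := ι) (k := k) (G := G) (K := K) (V := V)
      (x₀ := x₀) :=
  fun ρ S₀ hx₀ hS₀ => ⟨RestrictedTensorProduct k x₀, inferInstance, inferInstance,
    RestrictedTensorProduct.rep ρ hx₀, RestrictedTensorProduct.tprod k,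
    RestrictedTensorProduct.isRestrictedTensorProductRep ρ S₀ hx₀ hS₀⟩

end Existence

end Literature.NumberTheory.Automorphic
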